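import Mathlib
import HarnessLib
import Summits.HubbardSuperconductivity.HubbardSuperconductivity.Theorems.KLProgrammeKLRegimeTwoVolumeSectorScaleSucc
import Summits.HubbardSuperconductivity.HubbardSuperconductivity.Theorems.KLProgrammeKLRegimeTwoVolumeDoubledData
import Summits.HubbardSuperconductivity.HubbardSuperconductivity.Theorems.KLProgrammeKLRegimeTwoVolumeDoubledBlockData

/-!
# Route `KLProgramme` — crux K3, VL child `KLRegimeVolumeLimitV17F2` (stmt-HubbardSuperconductivity-20440), (vi) blueprint v4 M3d: ONE SCALE OF THE
# TWO-VOLUME INDUCTION ON THE DOUBLED SECTOR-FIELD LEGS (alive sector fields ⊕ spectator «source» legs; seat hubbard-kl-k3c4-p1 g11; `--supports` 20440)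

The doubled twin of `sector_sum_norm_kernel_twoVolume_scaleSucc_le` (p581610) — the instance the VL stub reads (token #24: the source legs of `klSrcAction`
are spectators; tower identity `map_doubleRows_effAction_eq_map_doubleBlock_effAction`): legs `(SpaceTimeIdx V M × SectorLeg N) × Fin 2`, STEP covariances
= the SPECTATOR lifts `C⁺_V` of the sampled sector pull-backs `C_V`, re-sectorisations = the block substitutions `T⁺_V = T_V ⊕ J_V`, `T_V = ε•E_V(F′)·S_V(F̃₁)`
sampled, `J_V` the source-leg relabelling (its periodisation `hPJ` a hypothesis).  Discharged: pieces, block embeddings, (P) for `C⁺` (`spectatorCov_periodise`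
∘ `sectorPullback_periodise_leg`) and `T⁺` (`doubleBlock_periodise` ∘ `sectorOverlap_periodise_leg`), antisymmetry, (G1)/(G2), fibre-tail near entries, the
torus-distance geometry on the alive coordinates, Gram families, and the LIFT of every one-volume covariance datum from `C_V` to `C⁺_V` (`…TwoVolumeSpectatorLegs`,
`…TwoVolumeDoubledData`).  Hypotheses: the undoubled covariance data of p581610, the doubled profiles `Nw, NV, NW′`, the doubled transfer data of `T⁺_{L″}`,
the doubled scale-`j` data `Nj, Nfarj, Ej, NDj`, `Ein`, smallness.  **`srcSector_sum_norm_kernel_twoVolume_scaleSucc_le`**.  Sorry-free; no definition.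
References: BGM 2006 §2.7 (2.70)–(2.71), §2.9, §3; Salmhofer 1999 §4.2.4, (2.102)–(2.106).
-/

noncomputable section

namespace Summit.HubbardSuperconductivity.HubbardSuperconductivity.Theorems.TwoVolumeDefect

set_option linter.dupNamespace false -- summit = problem name (single-conjunct summit), D-0017

open Finset Literature.MathematicalPhysics.QuantumLattice GrassmannAlgebra Literature.Probability.LatticeModels
  Literature.Probability.LatticeModels.BattleFederbush
open Summit.HubbardSuperconductivity.HubbardSuperconductivity.Theorems.TwoPointAssembly

set_option maxHeartbeats 400000 in -- the instantiated 120-binder scale successor on doubled product legs elaborates in ≈ 1.5× the default budget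
/-- **ONE SCALE OF THE TWO-VOLUME INDUCTION ON THE DOUBLED SECTOR-FIELD LEGS OF TWO NESTED TORI** (see the module docstring).
[folklore; BGM 2006 §2.7, §2.9, §3; Salmhofer 1999 (2.102)–(2.106)] -/
theorem srcSector_sum_norm_kernel_twoVolume_scaleSucc_le {b L Lf M N N₁ : ℕ} [NeZero Lf] [NeZero L] [NeZero M]
    [LinearOrder ((SpaceTimeIdx Lf M × SectorLeg N) × Fin 2)]
    (hLf : Lf = b * L) {β : ℝ} (hβ : β ≠ 0)
    -- the block structures of the scale-`j+1` and scale-`j` legs and their doublings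
    (e : (SpaceTimeIdx Lf M × SectorLeg N) ≃ (Fin 2 → Fin b) × (SpaceTimeIdx L M × SectorLeg N))
    (he1 : ∀ X' i, ((e X').1 i : ℕ) = (X'.1.2 i).val / L) (he2 : ∀ X', (e X').2 = ((X'.1.1, fun i => (((X'.1.2 i).val : ℕ) : ZMod L)), X'.2))
    (ed : ((SpaceTimeIdx Lf M × SectorLeg N) × Fin 2) ≃ (Fin 2 → Fin b) × ((SpaceTimeIdx L M × SectorLeg N) × Fin 2)) (hed : ∀ x s, ed (x, s) = ((e x).1, ((e x).2, s)))
    (e₁ : (SpaceTimeIdx Lf M × SectorLeg N₁) ≃ (Fin 2 → Fin b) × (SpaceTimeIdx L M × SectorLeg N₁))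
    (he₁2 : ∀ X', (e₁ X').2 = ((X'.1.1, fun i => (((X'.1.2 i).val : ℕ) : ZMod L)), X'.2))
    (ed₁ : ((SpaceTimeIdx Lf M × SectorLeg N₁) × Fin 2) ≃ (Fin 2 → Fin b) × ((SpaceTimeIdx L M × SectorLeg N₁) × Fin 2)) (hed₁ : ∀ x s, ed₁ (x, s) = ((e₁ x).1, ((e₁ x).2, s)))
    -- the sampled fat family and symbol of the STEP covariances, the spectator lifts
    (𝔣t : Fin N → MatsubaraIdx M → (Fin 2 → ℝ) → ℂ) (Φ : MatsubaraIdx M → Fin 2 → (Fin 2 → ℝ) → ℂ)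
    (FtL : Fin N → FreqMomentum L M → ℂ) (FtLf : Fin N → FreqMomentum Lf M → ℂ)
    (hFtL : ∀ ω i q, FtL ω (i, q) = 𝔣t ω i (latticeMomentum L q)) (hFtLf : ∀ ω i q, FtLf ω (i, q) = 𝔣t ω i (latticeMomentum Lf q))
    (pL : FreqMomentum L M × Fin 2 → ℂ) (pLf : FreqMomentum Lf M × Fin 2 → ℂ)
    (hpL : ∀ i q σ, pL ((i, q), σ) = ((β * (L : ℝ) ^ 2 : ℝ) : ℂ) * Φ i σ (latticeMomentum L q))
    (hpLf : ∀ i q σ, pLf ((i, q), σ) = ((β * (Lf : ℝ) ^ 2 : ℝ) : ℂ) * Φ i σ (latticeMomentum Lf q))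
    (CL : Matrix (SpaceTimeIdx L M × SectorLeg N) (SpaceTimeIdx L M × SectorLeg N) ℂ)
    (hCL : CL = (sectorSubMatrix L M β FtL).transpose * normalCovariance L M pL * sectorSubMatrix L M β FtL)
    (CLf : Matrix (SpaceTimeIdx Lf M × SectorLeg N) (SpaceTimeIdx Lf M × SectorLeg N) ℂ)
    (hCLf : CLf = (sectorSubMatrix Lf M β FtLf).transpose * normalCovariance Lf M pLf * sectorSubMatrix Lf M β FtLf)
    (Cd : Matrix ((SpaceTimeIdx L M × SectorLeg N) × Fin 2) ((SpaceTimeIdx L M × SectorLeg N) × Fin 2) ℂ) (hCd : ∀ p q, Cd p q = if p.2 = 0 ∧ q.2 = 0 then CL p.1 q.1 else 0)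
    (Cd' : Matrix ((SpaceTimeIdx Lf M × SectorLeg N) × Fin 2) ((SpaceTimeIdx Lf M × SectorLeg N) × Fin 2) ℂ) (hCd' : ∀ p q, Cd' p q = if p.2 = 0 ∧ q.2 = 0 then CLf p.1 q.1 else 0)
    -- the sampled re-sectorisations `T_V = ε • E_V(F′)·S_V(F̃₁)`, the source relabellings `J_V`, the block substitutions `T⁺_V`
    (𝔣' : Fin N → MatsubaraIdx M → (Fin 2 → ℝ) → ℂ) (𝔣₁ : Fin N₁ → MatsubaraIdx M → (Fin 2 → ℝ) → ℂ)
    (F'L : Fin N → FreqMomentum L M → ℂ) (F'Lf : Fin N → FreqMomentum Lf M → ℂ)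
    (hF'L : ∀ ω i q, F'L ω (i, q) = 𝔣' ω i (latticeMomentum L q)) (hF'Lf : ∀ ω i q, F'Lf ω (i, q) = 𝔣' ω i (latticeMomentum Lf q))
    (F₁L : Fin N₁ → FreqMomentum L M → ℂ) (F₁Lf : Fin N₁ → FreqMomentum Lf M → ℂ)
    (hF₁L : ∀ ω i q, F₁L ω (i, q) = 𝔣₁ ω i (latticeMomentum L q)) (hF₁Lf : ∀ ω i q, F₁Lf ω (i, q) = 𝔣₁ ω i (latticeMomentum Lf q))
    (Tc : Matrix (SpaceTimeIdx L M × SectorLeg N) (SpaceTimeIdx L M × SectorLeg N₁) ℂ)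
    (hTc : Tc = ((imagTimeWeight β M : ℝ) : ℂ) • (sectorAnalysisMatrix L M β F'L * sectorSubMatrix L M β F₁L))
    (Tf : Matrix (SpaceTimeIdx Lf M × SectorLeg N) (SpaceTimeIdx Lf M × SectorLeg N₁) ℂ)
    (hTf : Tf = ((imagTimeWeight β M : ℝ) : ℂ) • (sectorAnalysisMatrix Lf M β F'Lf * sectorSubMatrix Lf M β F₁Lf))
    (Jc : Matrix (SpaceTimeIdx L M × SectorLeg N) (SpaceTimeIdx L M × SectorLeg N₁) ℂ) (Jf : Matrix (SpaceTimeIdx Lf M × SectorLeg N) (SpaceTimeIdx Lf M × SectorLeg N₁) ℂ)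
    (hPJ : ∀ (X' : (SpaceTimeIdx Lf M × SectorLeg N)) (Y : (SpaceTimeIdx L M × SectorLeg N₁)),
      ∑ Y'' ∈ univ.filter (fun Y'' : (SpaceTimeIdx Lf M × SectorLeg N₁) => (e₁ Y'').2 = Y), Jf X' Y'' = Jc (e X').2 Y)
    (Tpc : Matrix ((SpaceTimeIdx L M × SectorLeg N) × Fin 2) ((SpaceTimeIdx L M × SectorLeg N₁) × Fin 2) ℂ)
    (hTpc : ∀ p' p, Tpc p' p = if p'.2 = 0 ∧ p.2 = 0 then Tc p'.1 p.1 else if p'.2 = 1 ∧ p.2 = 1 then Jc p'.1 p.1 else 0)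
    (Tpf : Matrix ((SpaceTimeIdx Lf M × SectorLeg N) × Fin 2) ((SpaceTimeIdx Lf M × SectorLeg N₁) × Fin 2) ℂ)
    (hTpf : ∀ p' p, Tpf p' p = if p'.2 = 0 ∧ p.2 = 0 then Tf p'.1 p.1 else if p'.2 = 1 ∧ p.2 = 1 then Jf p'.1 p.1 else 0)
    -- depth of the zone, extra depth of the pin, the pin (alive or source)
    (R R' : ℕ) (w : ((SpaceTimeIdx Lf M × SectorLeg N) × Fin 2)) (hw : ∀ j, R + R' ≤ (w.1.1.2 j).val % L ∧ (w.1.1.2 j).val % L + (R + R') < L)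
    -- decay numbers of the two UNDOUBLED STEP covariances
    {T : ℝ} (hT0 : 0 < T)
    (hT : ∀ X', ∑ Y' ∈ univ.filter (fun Y' : (SpaceTimeIdx Lf M × SectorLeg N) => R < Torus.tnorm (X'.1.2 - Y'.1.2)), ‖CLf X' Y'‖ ≤ T)
    {Te : ℝ} (hTe : ∀ X' Y' : (SpaceTimeIdx Lf M × SectorLeg N),
      ∑ Y'' ∈ univ.filter (fun Y'' : (SpaceTimeIdx Lf M × SectorLeg N) => (e Y'').2 = (e Y').2 ∧ R < Torus.tnorm (X'.1.2 - Y''.1.2)), ‖CLf X' Y''‖ ≤ Te)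
    {s s' : ℝ} (hs0 : 0 ≤ s) (hs'0 : 0 ≤ s') (hs : ∀ X Y, ‖CL X Y‖ ≤ s) (hs' : ∀ X' Y', ‖CLf X' Y'‖ ≤ s')
    {α α' : ℝ} (hαα : 0 < α' + α) (hrow : ∀ X, ∑ Y, ‖CL X Y‖ ≤ α) (hrow' : ∀ X', ∑ Y', ‖CLf X' Y'‖ ≤ α')
    {m₁ m₁' : ℝ} (hm0 : 0 ≤ m₁) (hm0' : 0 ≤ m₁')
    (hm1 : ∀ X, ∑ Y, ‖CL X Y‖ * (Torus.tnorm (X.1.2 - Y.1.2) : ℝ) ≤ m₁)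
    (hm1' : ∀ X', ∑ Y', ‖CLf X' Y'‖ *
      (Torus.tnorm ((fun i => (((X'.1.2 i).val : ℕ) : ZMod L)) - fun i => (((Y'.1.2 i).val : ℕ) : ZMod L)) : ℝ) ≤ m₁')
    {κ κ' : ℝ} (hκ : 0 < κ) (hκ' : 0 < κ') (hGB : IsGramBoundedR CL κ) (hGB' : IsGramBoundedR CLf κ')
    {αw : ℝ} (hαw : 0 < αw)
    (hroww : ∀ X', ∑ Y', ‖CLf X' Y'‖ *
      (1 + (Torus.tnorm ((fun i => (((X'.1.2 i).val : ℕ) : ZMod L)) - fun i => (((Y'.1.2 i).val : ℕ) : ZMod L)) : ℝ)) ≤ αw)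
    (hcolw : ∀ Y', ∑ X', ‖CLf X' Y'‖ *
      (1 + (Torus.tnorm ((fun i => (((X'.1.2 i).val : ℕ) : ZMod L)) - fun i => (((Y'.1.2 i).val : ℕ) : ZMod L)) : ℝ)) ≤ αw)
    -- the two DOUBLED scale-`j` actions, the coarse unit and OUTPUT weighted profile, two smallness conditions
    (𝒲 : GrassmannAlgebra ℂ ((SpaceTimeIdx L M × SectorLeg N₁) × Fin 2)) (h𝒲e : 𝒲 ∈ evenOdd ℂ 0) (h𝒲0 : constPart ℂ 𝒲 = 0)
    (𝒲' : GrassmannAlgebra ℂ ((SpaceTimeIdx Lf M × SectorLeg N₁) × Fin 2)) (h𝒲'e : 𝒲' ∈ evenOdd ℂ 0) (h𝒲'0 : constPart ℂ 𝒲' = 0)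
    (hZ : IsUnit (effPartitionFn ℂ Cd (ExteriorAlgebra.map (Matrix.toLin' Tpc) 𝒲)))
    (Nw : ℕ → ℝ) (hNw0 : ∀ m, 0 ≤ Nw m)
    (hNw : ∀ (m' : ℕ) (j : Fin (2 * m')) (x : ((SpaceTimeIdx L M × SectorLeg N) × Fin 2)),
      ∑ Y ∈ univ.filter (fun Y : Fin (2 * m') → ((SpaceTimeIdx L M × SectorLeg N) × Fin 2) => Y j = x),
        ‖kernel ℂ (effAction ℂ Cd (ExteriorAlgebra.map (Matrix.toLin' Tpc) 𝒲)) (2 * m') Y‖ *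
          (1 + labelDiam (fun Y₁ Y₂ : ((SpaceTimeIdx L M × SectorLeg N) × Fin 2) => (Torus.tnorm (Y₁.1.1.2 - Y₂.1.1.2) : ℝ)) (univ.image Y)) ≤ Nw m')
    {ρf : ℝ} (hρf : 0 < ρf)
    (hθw : Real.exp 1 * (α' + α + (m₁' + m₁)) * normV ((SpaceTimeIdx Lf M × SectorLeg N) × Fin 2) (κ' + κ) ρf Nw / (κ' + κ) ^ 2 < 1)
    {ρ₂ : ℝ} (hρ₂ : 0 < ρ₂)
    (hθ₂ : Real.exp 1 * (α' + α + (m₁' + m₁)) * normV ((SpaceTimeIdx Lf M × SectorLeg N) × Fin 2) (κ' + κ + (κ' + κ + (κ' + κ))) ρ₂ Nw /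
      (κ' + κ + (κ' + κ + (κ' + κ))) ^ 2 < 1)
    -- the two re-sectorised DOUBLED input profiles
    (NV NW' : ℕ → ℝ) (hNV0 : ∀ m', 0 ≤ NV m') (hNW'0 : ∀ m', 0 ≤ NW' m')
    (hNV : ∀ m' (j : Fin (2 * m')) (x : ((SpaceTimeIdx L M × SectorLeg N) × Fin 2)),
      ∑ Y ∈ univ.filter (fun Y : Fin (2 * m') → ((SpaceTimeIdx L M × SectorLeg N) × Fin 2) => Y j = x),
        ‖kernel ℂ (ExteriorAlgebra.map (Matrix.toLin' Tpc) 𝒲) (2 * m') Y‖ *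
          (1 + labelDiam (fun Y₁ Y₂ : ((SpaceTimeIdx L M × SectorLeg N) × Fin 2) => (Torus.tnorm (Y₁.1.1.2 - Y₂.1.1.2) : ℝ)) (univ.image Y)) ≤ NV m')
    (hNW' : ∀ m' (j : Fin (2 * m')) (x : ((SpaceTimeIdx Lf M × SectorLeg N) × Fin 2)),
      ∑ Y ∈ univ.filter (fun Y : Fin (2 * m') → ((SpaceTimeIdx Lf M × SectorLeg N) × Fin 2) => Y j = x),
        ‖kernel ℂ (ExteriorAlgebra.map (Matrix.toLin' Tpf) 𝒲') (2 * m') Y‖ *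
          (1 + labelDiam (fun Y₁ Y₂ : ((SpaceTimeIdx Lf M × SectorLeg N) × Fin 2) =>
            (Torus.tnorm ((fun i => (((Y₁.1.1.2 i).val : ℕ) : ZMod L)) - fun i => (((Y₂.1.1.2 i).val : ℕ) : ZMod L)) : ℝ)) (univ.image Y)) ≤ NW' m')
    -- the DOUBLED transfer data of `T⁺_{L″}`: radii of the regions, column / window / row bounds `aT`, tails `τT`
    (RN RZ RF : ℕ) (hNZ : RN ≤ RZ) {aT τT : ℝ} (haT : 0 ≤ aT) (hτT : 0 ≤ τT)
    (hcolT : ∀ y', ∑ x, ‖Tpf x y'‖ ≤ aT)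
    (hwinT : ∀ (β' : Fin 2 → Fin b) (y : ((SpaceTimeIdx L M × SectorLeg N₁) × Fin 2)),
      ∑ β, ∑ x ∈ univ.filter (fun x : ((SpaceTimeIdx Lf M × SectorLeg N) × Fin 2) => (ed x).1 = β'), ‖Tpf x (ed₁.symm (β, y))‖ ≤ aT)
    (hρT : ∀ x : ((SpaceTimeIdx Lf M × SectorLeg N) × Fin 2), (∀ j, R ≤ (x.1.1.2 j).val % L ∧ (x.1.1.2 j).val % L + R < L) → ∑ y, ‖Tpf x (ed₁.symm ((ed x).1, y))‖ ≤ aT)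
    (hrowFT : ∀ x : ((SpaceTimeIdx Lf M × SectorLeg N) × Fin 2), (∀ j, R ≤ (x.1.1.2 j).val % L ∧ (x.1.1.2 j).val % L + R < L) →
      ∑ y' ∈ univ.filter (fun y' : ((SpaceTimeIdx Lf M × SectorLeg N₁) × Fin 2) => Torus.tnorm (x.1.1.2 - y'.1.1.2) ≤ RF), ‖Tpf x y'‖ ≤ aT)
    (hτFT : ∀ x : ((SpaceTimeIdx Lf M × SectorLeg N) × Fin 2), (∀ j, R ≤ (x.1.1.2 j).val % L ∧ (x.1.1.2 j).val % L + R < L) →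
      ∑ y' ∈ univ.filter (fun y' : ((SpaceTimeIdx Lf M × SectorLeg N₁) × Fin 2) => ¬ Torus.tnorm (x.1.1.2 - y'.1.1.2) ≤ RF), ‖Tpf x y'‖ ≤ τT)
    (hτ₁T : ∀ x : ((SpaceTimeIdx Lf M × SectorLeg N) × Fin 2), (∀ j, R ≤ (x.1.1.2 j).val % L ∧ (x.1.1.2 j).val % L + R < L) →
      ∀ y : ((SpaceTimeIdx L M × SectorLeg N₁) × Fin 2), ¬ RZ < Torus.tnorm ((ed x).2.1.1.2 - y.1.1.2) →
        ∑ x₂ ∈ univ.filter (fun x₂ : ((SpaceTimeIdx Lf M × SectorLeg N) × Fin 2) => (ed x₂).1 ≠ (ed x).1), ‖Tpf x₂ (ed₁.symm ((ed x).1, y))‖ ≤ τT)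
    (hτ₂T : ∀ x : ((SpaceTimeIdx Lf M × SectorLeg N) × Fin 2), (∀ j, R ≤ (x.1.1.2 j).val % L ∧ (x.1.1.2 j).val % L + R < L) → ∑ β ∈ univ.erase (ed x).1, ∑ y, ‖Tpf x (ed₁.symm (β, y))‖ ≤ τT)
    (hτ₃T : ∀ x : ((SpaceTimeIdx Lf M × SectorLeg N) × Fin 2), (∀ j, R ≤ (x.1.1.2 j).val % L ∧ (x.1.1.2 j).val % L + R < L) →
      ∑ y ∈ univ.filter (fun y : ((SpaceTimeIdx L M × SectorLeg N₁) × Fin 2) => ¬ Torus.tnorm ((ed x).2.1.1.2 - y.1.1.2) ≤ RN), ‖Tpf x (ed₁.symm ((ed x).1, y))‖ ≤ τT)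
    (hτ₄T : ∀ x : ((SpaceTimeIdx Lf M × SectorLeg N) × Fin 2), (∀ j, R ≤ (x.1.1.2 j).val % L ∧ (x.1.1.2 j).val % L + R < L) →
      ∀ y : ((SpaceTimeIdx L M × SectorLeg N₁) × Fin 2), ¬ RZ < Torus.tnorm ((ed x).2.1.1.2 - y.1.1.2) →
        ∑ β ∈ univ.erase (ed x).1, ∑ x₂ ∈ univ.filter (fun x₂ : ((SpaceTimeIdx Lf M × SectorLeg N) × Fin 2) => (ed x₂).1 = (ed x).1), ‖Tpf x₂ (ed₁.symm (β, y))‖ ≤ τT)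
    -- ONE-volume scale-`j` DOUBLED profiles of the coarse action and the scale-`j` TWO-VOLUME data (block-reduced form), the majorant `Ein`
    (Nj Nfarj Ej NDj : ℕ → ℝ) (hNj0 : ∀ k, 0 ≤ Nj k) (hNfarj0 : ∀ k, 0 ≤ Nfarj k) (hEj0 : ∀ k, 0 ≤ Ej k) (hNDj0 : ∀ k, 0 ≤ NDj k)
    (hNj : ∀ (k : ℕ) (p : Fin k) (y : ((SpaceTimeIdx L M × SectorLeg N₁) × Fin 2)),
      ∑ Y ∈ univ.filter (fun Y : Fin k → ((SpaceTimeIdx L M × SectorLeg N₁) × Fin 2) => Y p = y), ‖kernel ℂ 𝒲 k Y‖ ≤ Nj k)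
    (hNfarj : ∀ (k : ℕ) (p : Fin k) (y : ((SpaceTimeIdx L M × SectorLeg N₁) × Fin 2)) (i : Fin k),
      ∑ Y ∈ univ.filter (fun Y : Fin k → ((SpaceTimeIdx L M × SectorLeg N₁) × Fin 2) => Y p = y ∧ RZ - RN < Torus.tnorm ((Y p).1.1.2 - (Y i).1.1.2)),
        ‖kernel ℂ 𝒲 k Y‖ ≤ Nfarj k)
    (hEj : ∀ x : ((SpaceTimeIdx Lf M × SectorLeg N) × Fin 2), (∀ j, R ≤ (x.1.1.2 j).val % L ∧ (x.1.1.2 j).val % L + R < L) →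
      ∀ (k : ℕ) (p : Fin k) (y' : ((SpaceTimeIdx Lf M × SectorLeg N₁) × Fin 2)), Torus.tnorm (x.1.1.2 - y'.1.1.2) ≤ RF →
        ∑ Y' ∈ univ.filter (fun Y' : Fin k → ((SpaceTimeIdx Lf M × SectorLeg N₁) × Fin 2) => Y' p = y'),
          ‖kernel ℂ 𝒲' k Y' - (if ∀ i, (ed₁ (Y' i)).1 = (ed₁ (Y' p)).1 then kernel ℂ 𝒲 k (fun i => (ed₁ (Y' i)).2) else 0)‖ ≤ Ej k)
    (hNDj : ∀ (k : ℕ) (p : Fin k) (y' : ((SpaceTimeIdx Lf M × SectorLeg N₁) × Fin 2)),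
      ∑ Y' ∈ univ.filter (fun Y' : Fin k → ((SpaceTimeIdx Lf M × SectorLeg N₁) × Fin 2) => Y' p = y'),
        ‖kernel ℂ 𝒲' k Y' - (if ∀ i, (ed₁ (Y' i)).1 = (ed₁ (Y' p)).1 then kernel ℂ 𝒲 k (fun i => (ed₁ (Y' i)).2) else 0)‖ ≤ NDj k)
    (Ein : ℕ → ℝ) (hEin0 : ∀ m', 0 ≤ Ein m')
    (hEin : ∀ m', 1 ≤ m' → ∀ n : ℕ, 2 * m' = n + 1 → aT ^ n * (aT * Ej (n + 1) + τT * NDj (n + 1)) +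
      (2 * aT ^ n * τT * Nj (n + 1) + n * aT ^ n * (5 * τT * Nj (n + 1) + 2 * aT * Nfarj (n + 1))) ≤ Ein m')
    {ρ' : ℝ} (hρ' : 0 < ρ') {νEbar : ℝ} (hνE : normV ((SpaceTimeIdx Lf M × SectorLeg N) × Fin 2) κ' ρ' Ein ≤ νEbar)
    (hbar : Real.exp 1 * αw * (normV ((SpaceTimeIdx Lf M × SectorLeg N) × Fin 2) κ' ρ' (fun m' => NV m' + (NW' m' + NV m')) + νEbar) / κ' ^ 2 < 1)
    (hθ₂' : Real.exp 1 * αw * (normV ((SpaceTimeIdx Lf M × SectorLeg N) × Fin 2) κ' ρ' NV + normV ((SpaceTimeIdx Lf M × SectorLeg N) × Fin 2) κ' ρ' (fun m' => NW' m' + NV m')) / κ' ^ 2 < 1)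
    (n : ℕ) (p : Fin (n + 1)) :
    ∑ X ∈ univ.filter (fun X : Fin (n + 1) → ((SpaceTimeIdx Lf M × SectorLeg N) × Fin 2) => X p = w),
        ‖kernel ℂ (effAction ℂ Cd' (ExteriorAlgebra.map (Matrix.toLin' Tpf) 𝒲')) (n + 1) X -
          (if ∀ i, (ed (X i)).1 = (ed (X p)).1 then
            kernel ℂ (effAction ℂ Cd (ExteriorAlgebra.map (Matrix.toLin' Tpc) 𝒲)) (n + 1) (fun i => (ed (X i)).2) else 0)‖ ≤
      (ρ'⁻¹ ^ (n + 1) * Real.exp 1 / (1 - Real.exp 1 * αw * (normV ((SpaceTimeIdx Lf M × SectorLeg N) × Fin 2) κ' ρ' (fun m' => NV m' + (NW' m' + NV m')) + νEbar) / κ' ^ 2) ^ 2) * normV ((SpaceTimeIdx Lf M × SectorLeg N) × Fin 2) κ' ρ' Ein +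
        (ρ'⁻¹ ^ (n + 1) * (Real.exp 1 * normV ((SpaceTimeIdx Lf M × SectorLeg N) × Fin 2) κ' ρ' (fun m' => NW' m' + NV m')) / (1 - Real.exp 1 * αw * (normV ((SpaceTimeIdx Lf M × SectorLeg N) × Fin 2) κ' ρ' NV + normV ((SpaceTimeIdx Lf M × SectorLeg N) × Fin 2) κ' ρ' (fun m' => NW' m' + NV m')) / κ' ^ 2) ^ 2) * (1 + ((R' : ℝ) + 1))⁻¹ +
        ((((n + 1 + 1) * (n + 1 + 2) : ℕ) : ℝ) / 2 *
            (ρ₂⁻¹ ^ (n + 3) * (Real.exp 1 * normV ((SpaceTimeIdx Lf M × SectorLeg N) × Fin 2) (κ' + κ + (κ' + κ + (κ' + κ))) ρ₂ Nw) / (1 - Real.exp 1 * (α' + α + (m₁' + m₁)) * normV ((SpaceTimeIdx Lf M × SectorLeg N) × Fin 2) (κ' + κ + (κ' + κ + (κ' + κ))) ρ₂ Nw / (κ' + κ + (κ' + κ + (κ' + κ))) ^ 2))) * Te +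
        (‖(2 : ℂ)⁻¹‖ * ∑ a ∈ range (n + 2), ∑ b ∈ range (n + 2),
            (if a + b = n + 1 then (((a + 1) * (b + 1) : ℕ) : ℝ) *
              (4 * (ρ₂⁻¹ ^ (a + 1) * (Real.exp 1 * normV ((SpaceTimeIdx Lf M × SectorLeg N) × Fin 2) (κ' + κ + (κ' + κ + (κ' + κ))) ρ₂ Nw) / (1 - Real.exp 1 * (α' + α + (m₁' + m₁)) * normV ((SpaceTimeIdx Lf M × SectorLeg N) × Fin 2) (κ' + κ + (κ' + κ + (κ' + κ))) ρ₂ Nw / (κ' + κ + (κ' + κ + (κ' + κ))) ^ 2)) *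
                (ρ₂⁻¹ ^ (b + 1) * (Real.exp 1 * normV ((SpaceTimeIdx Lf M × SectorLeg N) × Fin 2) (κ' + κ + (κ' + κ + (κ' + κ))) ρ₂ Nw) / (1 - Real.exp 1 * (α' + α + (m₁' + m₁)) * normV ((SpaceTimeIdx Lf M × SectorLeg N) × Fin 2) (κ' + κ + (κ' + κ + (κ' + κ))) ρ₂ Nw / (κ' + κ + (κ' + κ + (κ' + κ))) ^ 2))) else 0)) * T +
        ((((n + 1 + 1) * (n + 1 + 2) : ℕ) : ℝ) / 2 * (s' + s) *
              (ρf⁻¹ ^ (n + 3) * (Real.exp 1 * normV ((SpaceTimeIdx Lf M × SectorLeg N) × Fin 2) (κ' + κ) ρf Nw) / (1 - Real.exp 1 * (α' + α + (m₁' + m₁)) * normV ((SpaceTimeIdx Lf M × SectorLeg N) × Fin 2) (κ' + κ) ρf Nw / (κ' + κ) ^ 2)) +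
            ‖(2 : ℂ)⁻¹‖ * ∑ a ∈ range (n + 2), ∑ b ∈ range (n + 2),
              (if a + b = n + 1 then (((a + 1) * (b + 1) : ℕ) : ℝ) *
                (2 * (α' + α) * (ρf⁻¹ ^ (a + 1) * (Real.exp 1 * normV ((SpaceTimeIdx Lf M × SectorLeg N) × Fin 2) (κ' + κ) ρf Nw) / (1 - Real.exp 1 * (α' + α + (m₁' + m₁)) * normV ((SpaceTimeIdx Lf M × SectorLeg N) × Fin 2) (κ' + κ) ρf Nw / (κ' + κ) ^ 2)) *
                  (ρf⁻¹ ^ (b + 1) * (Real.exp 1 * normV ((SpaceTimeIdx Lf M × SectorLeg N) × Fin 2) (κ' + κ) ρf Nw) / (1 - Real.exp 1 * (α' + α + (m₁' + m₁)) * normV ((SpaceTimeIdx Lf M × SectorLeg N) × Fin 2) (κ' + κ) ρf Nw / (κ' + κ) ^ 2))) else 0)) * ((R' : ℝ) + 1)⁻¹ := by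
  classical
  -- readings of the doubled block structures
  have hed1 : ∀ X' : ((SpaceTimeIdx Lf M × SectorLeg N) × Fin 2), (ed X').1 = (e X'.1).1 := fun X' => by obtain ⟨x, s⟩ := X'; rw [hed]
  have hed2 : ∀ X' : ((SpaceTimeIdx Lf M × SectorLeg N) × Fin 2), (ed X').2 = ((e X'.1).2, X'.2) := fun X' => by obtain ⟨x, s⟩ := X'; rw [hed]
  -- block embeddings per box, at both scales
  set Fe : (Fin 2 → Fin b) → (((SpaceTimeIdx L M × SectorLeg N) × Fin 2) → ℂ) →ₗ[ℂ] (((SpaceTimeIdx Lf M × SectorLeg N) × Fin 2) → ℂ) := fun β' =>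
    LinearMap.pi (fun X' : ((SpaceTimeIdx Lf M × SectorLeg N) × Fin 2) => if (ed X').1 = β' then
      (LinearMap.proj (ed X').2 : (((SpaceTimeIdx L M × SectorLeg N) × Fin 2) → ℂ) →ₗ[ℂ] ℂ) else 0) with hFe_def
  have hFe : ∀ β' v X', Fe β' v X' = if (ed X').1 = β' then v (ed X').2 else 0 := fun β' v X' => blockEmb_pi_apply ℂ ed β' v X'
  set Fe₁ : (Fin 2 → Fin b) → (((SpaceTimeIdx L M × SectorLeg N₁) × Fin 2) → ℂ) →ₗ[ℂ] (((SpaceTimeIdx Lf M × SectorLeg N₁) × Fin 2) → ℂ) := fun β' =>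
    LinearMap.pi (fun X' : ((SpaceTimeIdx Lf M × SectorLeg N₁) × Fin 2) => if (ed₁ X').1 = β' then
      (LinearMap.proj (ed₁ X').2 : (((SpaceTimeIdx L M × SectorLeg N₁) × Fin 2) → ℂ) →ₗ[ℂ] ℂ) else 0) with hFe₁_def
  have hFe₁ : ∀ β' v X', Fe₁ β' v X' = if (ed₁ X').1 = β' then v (ed₁ X').2 else 0 := fun β' v X' => blockEmb_pi_apply ℂ ed₁ β' v X'
  -- the pieces on the doubled legs (zone = alive-coordinate non-deep legs)
  set Ccop : Matrix ((SpaceTimeIdx Lf M × SectorLeg N) × Fin 2) ((SpaceTimeIdx Lf M × SectorLeg N) × Fin 2) ℂ :=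
    Matrix.of fun X' Y' => if (ed X').1 = (ed Y').1 then Cd (ed X').2 (ed Y').2 else 0 with hCcop_def
  set Zs : Set ((SpaceTimeIdx Lf M × SectorLeg N) × Fin 2) := {X' | ¬ ∀ j, R ≤ (X'.1.1.2 j).val % L ∧ (X'.1.1.2 j).val % L + R < L} with hZs_def
  set Df : Matrix ((SpaceTimeIdx Lf M × SectorLeg N) × Fin 2) ((SpaceTimeIdx Lf M × SectorLeg N) × Fin 2) ℂ :=
    Matrix.of fun X' Y' => if X' ∈ Zs ∧ Y' ∈ Zs then Cd' X' Y' - Ccop X' Y' else 0 with hDf_def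
  set Dn : Matrix ((SpaceTimeIdx Lf M × SectorLeg N) × Fin 2) ((SpaceTimeIdx Lf M × SectorLeg N) × Fin 2) ℂ :=
    Matrix.of fun X' Y' => if X' ∈ Zs ∧ Y' ∈ Zs then 0 else Cd' X' Y' - Ccop X' Y' with hDn_def
  have hCcop : ∀ X' Y', Ccop X' Y' = if (ed X').1 = (ed Y').1 then Cd (ed X').2 (ed Y').2 else 0 := fun X' Y' => rfl
  have hDf : ∀ X' Y', Df X' Y' = if X' ∈ Zs ∧ Y' ∈ Zs then Cd' X' Y' - Ccop X' Y' else 0 := fun X' Y' => rfl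
  have hDn : ∀ X' Y', Dn X' Y' = if X' ∈ Zs ∧ Y' ∈ Zs then 0 else Cd' X' Y' - Ccop X' Y' := fun X' Y' => rfl
  -- (P) periodisation of the undoubled pull-backs, lifted to the spectators; of the re-sectorisations, lifted to the block substitutions; antisymmetry
  have hP₀ : ∀ (X' : (SpaceTimeIdx Lf M × SectorLeg N)) (Y : (SpaceTimeIdx L M × SectorLeg N)),
      ∑ Y'' ∈ univ.filter (fun Y'' : (SpaceTimeIdx Lf M × SectorLeg N) => (e Y'').2 = Y), CLf X' Y'' = CL (e X').2 Y := by
    intro X' Y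
    rw [hCL, hCLf]
    exact sectorPullback_periodise_leg hLf hβ 𝔣t Φ FtL FtLf hFtL hFtLf pL pLf hpL hpLf e he2 X' Y
  have hP : ∀ (X' : ((SpaceTimeIdx Lf M × SectorLeg N) × Fin 2)) (Y : ((SpaceTimeIdx L M × SectorLeg N) × Fin 2)),
      ∑ Y'' ∈ univ.filter (fun Y'' : ((SpaceTimeIdx Lf M × SectorLeg N) × Fin 2) => (ed Y'').2 = Y), Cd' X' Y'' = Cd (ed X').2 Y :=
    fun X' Y => spectatorCov_periodise e ed hed CL CLf Cd Cd' hCd hCd' hP₀ X' Y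
  have hPT₀ : ∀ (X' : (SpaceTimeIdx Lf M × SectorLeg N)) (Y : (SpaceTimeIdx L M × SectorLeg N₁)),
      ∑ Y'' ∈ univ.filter (fun Y'' : (SpaceTimeIdx Lf M × SectorLeg N₁) => (e₁ Y'').2 = Y), Tf X' Y'' = Tc (e X').2 Y := by
    intro X' Y
    rw [hTc, hTf]
    simp only [Matrix.smul_apply, smul_eq_mul, ← mul_sum]
    rw [sectorOverlap_periodise_leg hLf hβ 𝔣' 𝔣₁ F'L F'Lf hF'L hF'Lf F₁L F₁Lf hF₁L hF₁Lf e₁ he₁2 X' Y, he2]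
  have hPT : ∀ (X' : ((SpaceTimeIdx Lf M × SectorLeg N) × Fin 2)) (Y : ((SpaceTimeIdx L M × SectorLeg N₁) × Fin 2)),
      ∑ Y'' ∈ univ.filter (fun Y'' : ((SpaceTimeIdx Lf M × SectorLeg N₁) × Fin 2) => (ed₁ Y'').2 = Y), Tpf X' Y'' = Tpc (ed X').2 Y :=
    fun X' Y => doubleBlock_periodise e₁ e ed₁ hed₁ ed hed Tc Jc Tf Jf Tpc Tpf hTpc hTpf hPT₀ hPJ X' Y
  have hCt₀ : ∀ X Y, CL Y X = -CL X Y := fun X Y => by rw [hCL]; exact sectorPullback_swap β FtL pL X Y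
  have hC't₀ : ∀ X' Y', CLf Y' X' = -CLf X' Y' := fun X' Y' => by rw [hCLf]; exact sectorPullback_swap β FtLf pLf X' Y'
  have hCt : ∀ X Y, Cd Y X = -Cd X Y := fun X Y => by
    by_cases hX : X.2 = 0 <;> by_cases hY : Y.2 = 0 <;> simp [hCd, hX, hY, hCt₀ X.1 Y.1]
  have hC't : ∀ X' Y', Cd' Y' X' = -Cd' X' Y' := fun X' Y' => by
    by_cases hX : X'.2 = 0 <;> by_cases hY : Y'.2 = 0 <;> simp [hCd', hX, hY, hC't₀ X'.1 Y'.1]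
  -- geometry on the alive coordinates: (G1), (G2); distances; pin / zone; the transfer triangle
  have hG1 : ∀ X' Y', (ed X').1 ≠ (ed Y').1 → ¬ (X' ∈ Zs ∧ Y' ∈ Zs) → R < Torus.tnorm (X'.1.1.2 - Y'.1.1.2) := by
    intro X' Y' hne hnz
    rw [hed1, hed1] at hne
    exact sector_far_of_block_ne hLf e he1 hne hnz
  have hG2 : ∀ X' Y' Y'', (ed X').1 = (ed Y').1 → (ed Y'').2 = (ed Y').2 → Y'' ≠ Y' → ¬ (X' ∈ Zs ∧ Y' ∈ Zs) →
      R < Torus.tnorm (X'.1.1.2 - Y''.1.1.2) := by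
    intro X' Y' Y'' hb hf hn hnz
    rw [hed1, hed1] at hb
    rw [hed2, hed2, Prod.mk.injEq] at hf
    have hn1 : Y''.1 ≠ Y'.1 := fun h => hn (Prod.ext h hf.2)
    exact sector_far_of_fibre_ne hLf e he1 he2 hb hf.1 hn1 hnz
  set dc : ((SpaceTimeIdx L M × SectorLeg N) × Fin 2) → ((SpaceTimeIdx L M × SectorLeg N) × Fin 2) → ℝ := fun Y₁ Y₂ => (Torus.tnorm (Y₁.1.1.2 - Y₂.1.1.2) : ℝ) with hdc_def
  have hdc : IsLabelDist dc := isLabelDist_tnorm_sectorSite.comap (fun Y : ((SpaceTimeIdx L M × SectorLeg N) × Fin 2) => Y.1)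
  set d' : ((SpaceTimeIdx Lf M × SectorLeg N) × Fin 2) → ((SpaceTimeIdx Lf M × SectorLeg N) × Fin 2) → ℝ := fun X' Y' => dc (ed X').2 (ed Y').2 with hd'_def
  have hd' : IsLabelDist d' := hdc.comap (fun X' => (ed X').2)
  have hd'red : ∀ X' Y' : ((SpaceTimeIdx Lf M × SectorLeg N) × Fin 2), d' X' Y' =
      (Torus.tnorm ((fun i => (((X'.1.1.2 i).val : ℕ) : ZMod L)) - fun i => (((Y'.1.1.2 i).val : ℕ) : ZMod L)) : ℝ) := by
    intro X' Y'; simp only [hd'_def, hdc_def]; rw [hed2, hed2]; dsimp only; rw [he2, he2]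
  have hd'blk : ∀ (β' : Fin 2 → Fin b) (x y : ((SpaceTimeIdx L M × SectorLeg N) × Fin 2)), d' (ed.symm (β', x)) (ed.symm (β', y)) = dc x y := by
    intro β' x y; simp only [hd'_def, Equiv.apply_symm_apply]
  have hdR : ∀ X, X ∈ Zs → (R' : ℝ) + 1 ≤ dc (ed X).2 (ed w).2 := by
    intro X hX
    have h := tnorm_red_sub_gt_of_not_deep_of_deep (L := L) hX hw
    simp only [hdc_def]; rw [hed2, hed2]; dsimp only; rw [he2, he2]; exact_mod_cast Nat.succ_le_of_lt h
  have hwd : ∀ z : ((SpaceTimeIdx Lf M × SectorLeg N) × Fin 2), ¬ (∀ j, R ≤ (z.1.1.2 j).val % L ∧ (z.1.1.2 j).val % L + R < L) → (R' : ℝ) + 1 ≤ d' z w := by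
    intro z hz
    have h := tnorm_red_sub_gt_of_not_deep_of_deep (L := L) hz hw
    rw [hd'red]; exact_mod_cast Nat.succ_le_of_lt h
  have hZT : ∀ x : ((SpaceTimeIdx Lf M × SectorLeg N) × Fin 2), (∀ j, R ≤ (x.1.1.2 j).val % L ∧ (x.1.1.2 j).val % L + R < L) →
      ∀ y y' : ((SpaceTimeIdx L M × SectorLeg N₁) × Fin 2), Torus.tnorm ((ed x).2.1.1.2 - y.1.1.2) ≤ RN → RZ < Torus.tnorm ((ed x).2.1.1.2 - y'.1.1.2) →
        RZ - RN < Torus.tnorm (y.1.1.2 - y'.1.1.2) := by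
    intro x _ y y' hy hy'
    have htri := Torus.tnorm_add_le ((ed x).2.1.1.2 - y.1.1.2) (y.1.1.2 - y'.1.1.2)
    rw [sub_add_sub_cancel] at htri; omega
  -- LIFT of the undoubled covariance data to the spectators
  have hα'0 : 0 ≤ α' := le_trans (sum_nonneg fun _ _ => norm_nonneg _) (hrow' w.1)
  have hTe0 : 0 ≤ Te := le_trans (sum_nonneg fun _ _ => norm_nonneg _) (hTe w.1 w.1)
  have hTd : ∀ X', ∑ Y' ∈ univ.filter (fun Y' : ((SpaceTimeIdx Lf M × SectorLeg N) × Fin 2) => R < Torus.tnorm (X'.1.1.2 - Y'.1.1.2)), ‖Cd' X' Y'‖ ≤ T := by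
    intro X'
    have h := sum_filter_norm_spectatorCov_mul_row_le CLf Cd' hCd' (fun Y' : ((SpaceTimeIdx Lf M × SectorLeg N) × Fin 2) => R < Torus.tnorm (X'.1.1.2 - Y'.1.1.2))
      (fun _ => (1 : ℝ)) X' hT0.le (by simpa using hT X'.1)
    simpa using h
  have hTed : ∀ X' Y' : ((SpaceTimeIdx Lf M × SectorLeg N) × Fin 2),
      ∑ Y'' ∈ univ.filter (fun Y'' : ((SpaceTimeIdx Lf M × SectorLeg N) × Fin 2) => (ed Y'').2 = (ed Y').2 ∧ R < Torus.tnorm (X'.1.1.2 - Y''.1.1.2)), ‖Cd' X' Y''‖ ≤ Te := by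
    intro X' Y'
    have h := sum_filter_norm_spectatorCov_mul_row_le CLf Cd' hCd'
      (fun Y'' : ((SpaceTimeIdx Lf M × SectorLeg N) × Fin 2) => (ed Y'').2 = (ed Y').2 ∧ R < Torus.tnorm (X'.1.1.2 - Y''.1.1.2)) (fun _ => (1 : ℝ)) X' hTe0 ?_
    · simpa using h
    simp only [mul_one]
    by_cases hs : Y'.2 = 0
    · refine le_trans (le_of_eq (sum_congr ?_ fun _ _ => rfl)) (hTe X'.1 Y'.1)
      ext y
      simp only [mem_filter, mem_univ, true_and, hed, Prod.mk.injEq, hs, and_true]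
    · refine le_trans (le_of_eq ?_) hTe0
      refine sum_eq_zero fun y hy => ?_
      simp only [mem_filter, mem_univ, true_and, hed, Prod.mk.injEq] at hy
      exact absurd hy.1.2.symm hs
  have hsd : ∀ X Y, ‖Cd X Y‖ ≤ s := norm_spectatorCov_le CL Cd hCd hs0 hs
  have hs'd : ∀ X' Y', ‖Cd' X' Y'‖ ≤ s' := norm_spectatorCov_le CLf Cd' hCd' hs'0 hs'
  have hrowd : ∀ X, ∑ Y, ‖Cd X Y‖ ≤ α := fun X => (sum_norm_spectatorCov_row_le CL Cd hCd X).trans (hrow X.1)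
  have hrow'd : ∀ X', ∑ Y', ‖Cd' X' Y'‖ ≤ α' := fun X' => (sum_norm_spectatorCov_row_le CLf Cd' hCd' X').trans (hrow' X'.1)
  have hm1d : ∀ X, ∑ Y, ‖Cd X Y‖ * dc X Y ≤ m₁ := fun X =>
    sum_norm_spectatorCov_mul_row_le CL Cd hCd (fun Y => dc X Y) X hm0 (by simpa [hdc_def] using hm1 X.1)
  have hm1'd : ∀ X', ∑ Y', ‖Cd' X' Y'‖ * dc (ed X').2 (ed Y').2 ≤ m₁' := by
    intro X'
    refine sum_norm_spectatorCov_mul_row_le CLf Cd' hCd' (fun Y' => dc (ed X').2 (ed Y').2) X' hm0' ?_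
    refine le_trans (le_of_eq (sum_congr rfl fun Y' _ => ?_)) (hm1' X'.1)
    simp only [hdc_def]
    rw [hed2, hed]; dsimp only; rw [he2, he2]
  have hGBd : IsGramBoundedR Cd κ := isGramBoundedR_spectator CL Cd hCd hGB
  have hGB'd : IsGramBoundedR Cd' κ' := isGramBoundedR_spectator CLf Cd' hCd' hGB'
  -- the weight `φ(s) = 1 + s` and the weighted rows of the fine spectator
  set phi : ℝ → ℝ := fun t => 1 + t with hphi
  have hphi1 : ∀ t, 0 ≤ t → 1 ≤ phi t := fun t ht => by simp only [hphi]; linarith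
  have hphimono : ∀ s t, 0 ≤ s → s ≤ t → phi s ≤ phi t := fun s t _ hst => by simp only [hphi]; linarith
  have hphisub : ∀ s t, 0 ≤ s → 0 ≤ t → phi (s + t) ≤ phi s * phi t := fun s t hs ht => by simp only [hphi]; nlinarith
  have hpairw : ∀ X' Y' : ((SpaceTimeIdx Lf M × SectorLeg N) × Fin 2), diamWeight phi d' {X', Y'} =
      1 + (Torus.tnorm ((fun i => (((X'.1.1.2 i).val : ℕ) : ZMod L)) - fun i => (((Y'.1.1.2 i).val : ℕ) : ZMod L)) : ℝ) := by
    intro X' Y'; rw [diamWeight_pair hd', ← hd'red]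
  have hroww' : ∀ X', ∑ Y', ‖Cd' X' Y'‖ * diamWeight phi d' {X', Y'} ≤ αw := by
    intro X'
    simp only [hpairw]
    exact sum_norm_spectatorCov_mul_row_le CLf Cd' hCd'
      (fun Y' : ((SpaceTimeIdx Lf M × SectorLeg N) × Fin 2) => 1 + (Torus.tnorm ((fun i => (((X'.1.1.2 i).val : ℕ) : ZMod L)) - fun i => (((Y'.1.1.2 i).val : ℕ) : ZMod L)) : ℝ))
      X' hαw.le (hroww X'.1)
  have hcolw' : ∀ Y', ∑ X', ‖Cd' X' Y'‖ * diamWeight phi d' {X', Y'} ≤ αw := by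
    intro Y'
    simp only [hpairw]
    exact sum_norm_spectatorCov_mul_col_le CLf Cd' hCd'
      (fun X' : ((SpaceTimeIdx Lf M × SectorLeg N) × Fin 2) => 1 + (Torus.tnorm ((fun i => (((X'.1.1.2 i).val : ℕ) : ZMod L)) - fun i => (((Y'.1.1.2 i).val : ℕ) : ZMod L)) : ℝ))
      Y' hαw.le (hcolw Y'.1)
  have hwtc : ∀ {k : ℕ} (Y : Fin k → ((SpaceTimeIdx L M × SectorLeg N) × Fin 2)), diamWeight phi dc (univ.image Y) = 1 + labelDiam dc (univ.image Y) := fun Y => rfl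
  have hwtf : ∀ {k : ℕ} (Y : Fin k → ((SpaceTimeIdx Lf M × SectorLeg N) × Fin 2)), diamWeight phi d' (univ.image Y) = 1 + labelDiam d' (univ.image Y) := fun Y => rfl
  have hNVp : ∀ m' (j : Fin (2 * m')) (x : ((SpaceTimeIdx L M × SectorLeg N) × Fin 2)),
      ∑ Y ∈ univ.filter (fun Y : Fin (2 * m') → ((SpaceTimeIdx L M × SectorLeg N) × Fin 2) => Y j = x),
        ‖kernel ℂ (ExteriorAlgebra.map (Matrix.toLin' Tpc) 𝒲) (2 * m') Y‖ * diamWeight phi dc (univ.image Y) ≤ NV m' := by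
    intro m' j x; simp only [hwtc]; exact hNV m' j x
  have hlabf : ∀ {k : ℕ} (Y : Fin k → ((SpaceTimeIdx Lf M × SectorLeg N) × Fin 2)), labelDiam d' (univ.image Y) =
      labelDiam (fun Y₁ Y₂ : ((SpaceTimeIdx Lf M × SectorLeg N) × Fin 2) =>
        (Torus.tnorm ((fun i => (((Y₁.1.1.2 i).val : ℕ) : ZMod L)) - fun i => (((Y₂.1.1.2 i).val : ℕ) : ZMod L)) : ℝ)) (univ.image Y) := by
    intro k Y
    have hfun : d' = fun Y₁ Y₂ : ((SpaceTimeIdx Lf M × SectorLeg N) × Fin 2) =>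
        (Torus.tnorm ((fun i => (((Y₁.1.1.2 i).val : ℕ) : ZMod L)) - fun i => (((Y₂.1.1.2 i).val : ℕ) : ZMod L)) : ℝ) :=
      funext fun Y₁ => funext fun Y₂ => hd'red Y₁ Y₂
    rw [hfun]
  have hNW'p : ∀ m' (j : Fin (2 * m')) (x : ((SpaceTimeIdx Lf M × SectorLeg N) × Fin 2)),
      ∑ Y ∈ univ.filter (fun Y : Fin (2 * m') → ((SpaceTimeIdx Lf M × SectorLeg N) × Fin 2) => Y j = x),
        ‖kernel ℂ (ExteriorAlgebra.map (Matrix.toLin' Tpf) 𝒲') (2 * m') Y‖ * diamWeight phi d' (univ.image Y) ≤ NW' m' := by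
    intro m' j x; simp only [hwtf, hlabf]; exact hNW' m' j x
  -- the Gram PROPERTIES of the two defects
  have hGBcop : IsGramBoundedR Ccop κ := isGramBoundedR_blockCopies hGBd (fun X' => (ed X').1) (fun X' => (ed X').2) Ccop hCcop
  have hGBsub : IsGramBoundedR (Cd' - Ccop) (κ' + κ) := hGB'd.sub hGBcop hκ'.le
  have hGBf1 : IsGramBoundedR Df (κ' + κ) :=
    isGramBoundedR_mask hGBsub Zs Df (fun X' Y' => by rw [hDf, Matrix.sub_apply])
  have hGBf : ∀ t ∈ Set.Icc (0 : ℝ) 1, IsGramBoundedR (t • Df) (κ' + κ) := fun t ht => isGramBoundedR_real_smul hGBf1 ht.1 ht.2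
  have hDn_eq : Dn = (Cd' - Ccop) - Df := by
    ext X' Y'; rw [hDn, Matrix.sub_apply, Matrix.sub_apply, hDf]; split_ifs <;> simp
  have hGBn : IsGramBoundedR Dn (κ' + κ + (κ' + κ)) := by
    rw [hDn_eq]; exact hGBsub.sub hGBf1 (add_nonneg hκ'.le hκ.le)
  have hGB2 : ∀ t ∈ Set.Icc (0 : ℝ) 1, IsGramBoundedR (Df + t • Dn) (κ' + κ + (κ' + κ + (κ' + κ))) := fun t ht =>
    hGBf1.add (isGramBoundedR_real_smul hGBn ht.1 ht.2) (add_nonneg hκ'.le hκ.le)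
  -- the near entries from the fibre tails
  have hTe' : ∀ X' Y', ‖Dn X' Y'‖ ≤ Te :=
    norm_near_le_of_fibreTail ed Cd Cd' Ccop Dn Zs hCcop hDn hP (fun X' Y' => R < Torus.tnorm (X'.1.1.2 - Y'.1.1.2)) hG1 hG2 hTed
  -- the scale-`j` two-volume data in glued form
  have hsub₁ : ∀ {k : ℕ} (q : Fin k) (Y' : Fin k → ((SpaceTimeIdx Lf M × SectorLeg N₁) × Fin 2)),
      kernel ℂ (∑ β', ExteriorAlgebra.map (Fe₁ β') 𝒲) k Y' =
        if ∀ i, (ed₁ (Y' i)).1 = (ed₁ (Y' q)).1 then kernel ℂ 𝒲 k (fun i => (ed₁ (Y' i)).2) else 0 :=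
    fun q Y' => kernel_copies_sum ed₁ Fe₁ hFe₁ _ q Y'
  have hEj' : ∀ x : ((SpaceTimeIdx Lf M × SectorLeg N) × Fin 2), (∀ j, R ≤ (x.1.1.2 j).val % L ∧ (x.1.1.2 j).val % L + R < L) →
      ∀ (k : ℕ) (q : Fin k) (y' : ((SpaceTimeIdx Lf M × SectorLeg N₁) × Fin 2)), Torus.tnorm (x.1.1.2 - y'.1.1.2) ≤ RF →
        ∑ Y' ∈ univ.filter (fun Y' : Fin k → ((SpaceTimeIdx Lf M × SectorLeg N₁) × Fin 2) => Y' q = y'),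
          ‖kernel ℂ (𝒲' - ∑ β', ExteriorAlgebra.map (Fe₁ β') 𝒲) k Y'‖ ≤ Ej k := by
    intro x hx k q y' hy'; simp only [kernel_sub', hsub₁ q]; exact hEj x hx k q y' hy'
  have hNDj' : ∀ (k : ℕ) (q : Fin k) (y' : ((SpaceTimeIdx Lf M × SectorLeg N₁) × Fin 2)),
      ∑ Y' ∈ univ.filter (fun Y' : Fin k → ((SpaceTimeIdx Lf M × SectorLeg N₁) × Fin 2) => Y' q = y'),
        ‖kernel ℂ (𝒲' - ∑ β', ExteriorAlgebra.map (Fe₁ β') 𝒲) k Y'‖ ≤ NDj k := by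
    intro k q y'; simp only [kernel_sub', hsub₁ q]; exact hNDj k q y'
  -- the glued output kernel
  have hsub : ∀ X : Fin (n + 1) → ((SpaceTimeIdx Lf M × SectorLeg N) × Fin 2),
      kernel ℂ (∑ β', ExteriorAlgebra.map (Fe β') (effAction ℂ Cd (ExteriorAlgebra.map (Matrix.toLin' Tpc) 𝒲))) (n + 1) X =
        if ∀ i, (ed (X i)).1 = (ed (X p)).1 then
          kernel ℂ (effAction ℂ Cd (ExteriorAlgebra.map (Matrix.toLin' Tpc) 𝒲)) (n + 1) (fun i => (ed (X i)).2) else 0 :=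
    fun X => kernel_copies_sum ed Fe hFe _ p X
  simp_rw [← hsub]
  -- assemble the abstract scale successor
  have hmain := twoVolume_scale_succ_le ed₁ Fe₁ hFe₁ ed Cd Cd' Ccop Dn Df Zs hCcop hDf hDn hP
    (fun X' Y' => R < Torus.tnorm (X'.1.1.2 - Y'.1.1.2)) hG1 hG2 hT0 hTd hTe' hCt hC't hs0 hs'0 hsd hs'd hαα hrowd hrow'd
    dc hdc hm0 hm0' hm1d hm1'd
    (add_pos hκ' hκ) hGBf (add_pos (add_pos hκ' hκ) (add_pos (add_pos hκ' hκ) (add_pos hκ' hκ))) hGB2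
    (by positivity : (0 : ℝ) < (R' : ℝ) + 1) w hdR Fe hFe Tpc 𝒲 h𝒲e h𝒲0 hZ Nw hNw0 hNw hρf hθw hρ₂ hθ₂
    hκ' hGB'd d' hd' hphi1 hphimono hphisub Tpf 𝒲' h𝒲'e h𝒲'0 dc hd'blk NV NW' hNV0 hNW'0 hNVp ?iNW'
    (fun x : ((SpaceTimeIdx Lf M × SectorLeg N) × Fin 2) => ∀ j, R ≤ (x.1.1.2 j).val % L ∧ (x.1.1.2 j).val % L + R < L)
    (fun (x : ((SpaceTimeIdx Lf M × SectorLeg N) × Fin 2)) (y : ((SpaceTimeIdx L M × SectorLeg N₁) × Fin 2)) => RZ < Torus.tnorm ((ed x).2.1.1.2 - y.1.1.2))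
    (fun (x : ((SpaceTimeIdx Lf M × SectorLeg N) × Fin 2)) (y : ((SpaceTimeIdx L M × SectorLeg N₁) × Fin 2)) => Torus.tnorm ((ed x).2.1.1.2 - y.1.1.2) ≤ RN)
    (fun y y' : ((SpaceTimeIdx L M × SectorLeg N₁) × Fin 2) => RZ - RN < Torus.tnorm (y.1.1.2 - y'.1.1.2))
    (fun (x : ((SpaceTimeIdx Lf M × SectorLeg N) × Fin 2)) (y' : ((SpaceTimeIdx Lf M × SectorLeg N₁) × Fin 2)) => Torus.tnorm (x.1.1.2 - y'.1.1.2) ≤ RF)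
    haT hτT hPT hcolT hwinT hZT hρT hrowFT hτFT hτ₁T hτ₂T hτ₃T hτ₄T
    Nj Nfarj Ej NDj hNj0 hNfarj0 hEj0 hNDj0 hNj hNfarj hEj' hNDj' Ein hEin0 hEin
    hαw ?iroww ?icolw hρ' hνE hbar hθ₂' (by positivity : (0 : ℝ) ≤ (R' : ℝ) + 1) hwd n p
  -- (the Γ′-side weighted data are re-read in the step's `LinearOrder`-derived decidability instances)
  case iNW' => intro m' j x; convert hNW'p m' j x using 6
  case iroww => intro X'; convert hroww' X' using 6
  case icolw => intro Y'; convert hcolw' Y' using 6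
  convert hmain using 3

end Summit.HubbardSuperconductivity.HubbardSuperconductivity.Theorems.TwoVolumeDefect

end
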